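import Literature.NumberTheory.Transcendental.Analytification
import Literature.NumberTheory.Transcendental.AnalytificationProofs
import Literature.NumberTheory.Transcendental.AnalytificationSecondCountableProofs
import Literature.AlgebraicGeometry.Motives.BaseChangeProofs
import Literature.AlgebraicGeometry.Motives.VarietiesProjectiveSpaceProofs
import Mathlib.Analysis.Analytic.Polynomial
import HarnessLib

/-!
# `ℙⁿ(ℂ)` is the analytification of `ℙⁿ_ℂ` (proof file)

Sibling proof file of `Literature/NumberTheory/Transcendental/Analytification.lean`. That file
vendors as a *named fact* `Literature.NumberTheory.Transcendental.exists_isAnalytification_proj`: for every `n`, there is a map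
`φ : ℙ ℂ ℂⁿ⁺¹ → ℙⁿ_ℂ(ℂ)` from Mathlib's projectivization (with the quotient topology and the
standard atlas `Projectivization.instChartedSpace` of
`Literature/NumberTheory/Transcendental/ProjectiveSpace.lean`) to the complex points
`Literature.ComplexPoints (Literature.projectiveSpace n ℂ)` of the `ℂ`-scheme `ℙⁿ_ℂ = Proj ℂ[x₀, …, xₙ]`
(strong topology of `Literature/AlgebraicGeometry/Motives/AlgPoints.lean`) which is an
analytification (`Literature.NumberTheory.Transcendental.IsAnalytification`: a homeomorphism, `finrank ℂ ℂⁿ = n`, and regular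
functions on affine opens pull back to holomorphic functions) and which is compatible with
homogeneous coordinates (`φ⁻¹(D₊(F)(ℂ)) = ℙⁿ(ℂ) ∖ V(F)` for `F` homogeneous). This file
**discharges that fact** (`Literature.NumberTheory.Transcendental.exists_isAnalytification_proj_holds`) from Mathlib and the accepted
`AlgPoints`/`Analytification` API, with `φ = Literature.projPoint n`.

The printed source is Serre, GAGA §2 n°5 (pp. 8–9): Lemme 1 (a: the Zariski topology of `ℂⁿ` is
coarser than the usual one; b: Z-locally closed subsets are analytic; c: regular maps are
holomorphic; d: biregular isomorphisms are analytic isomorphisms) and Prop. 2 («Il existe sur `X`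
une structure d'espace analytique et une seule telle que, pour toute carte `φ : V → U`, l'ensemble
Z-ouvert `V` soit ouvert, et `φ` soit un isomorphisme analytique de `V` … sur `U`»), together with
the Remarque defining the topology of `X^h` as «la moins fine rendant continues les fonctions
régulières sur les sous-ensembles Z-ouverts de `X`» (this is `AlgPoints.instTopologicalSpace`).
For `X = ℙⁿ` the algebraic charts are the standard opens `D₊(xᵢ) ≅ 𝔸ⁿ`, `[z] ↦ (zⱼ/zᵢ)ⱼ`, which
are the charts `Projectivization.stdChart i` of the standard atlas; so `ℙⁿ(ℂ)` with the standard
atlas is `(ℙⁿ)^h`. (The docstring of the fact cites «§2 Exemple 2»; there is no such item in the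
paper, the relevant statements are n°5 Lemme 1 and Prop. 2.)

## Construction and proof

* `Literature.pointOfVec n z hz : ℙⁿ_ℂ(ℂ)` for `z ≠ 0` is Mathlib's `Proj.fromOfGlobalSections` for the
  ring map `F ↦ F(z)`, `ℂ[x₀,…,xₙ] → Γ(Spec ℂ, ⊤)` (the irrelevant ideal generates the unit ideal
  since some `zᵢ ≠ 0`); it is a morphism over `Spec ℂ` (`Proj.fromOfGlobalSections_toSpecZero`)
  and lies in `D₊(F)` iff `F(z) ≠ 0` for `F` homogeneous of positive degree
  (`Proj.fromOfGlobalSections_preimage_basicOpen`; `Literature.NumberTheory.Transcendental.pt_pointOfVec_mem_basicOpen_iff`).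
* Points of `Proj A` are determined by the basic opens `D₊(f)`, `deg f > 0`, containing them
  (`Literature.NumberTheory.Transcendental.Proj.ext_of_forall_mem_basicOpen_iff`), and complex points of a `ℂ`-scheme locally of
  finite type by their underlying point (`Literature.AlgebraicGeometry.Motives.ComplexPoints.ext_of_pt_eq`, Nullstellensatz via the
  accepted `ComplexPoints.equivClosedPoints`). Hence `pointOfVec` is invariant under rescaling and
  descends to `Literature.projPoint n : ℙ ℂ ℂⁿ⁺¹ → ℙⁿ_ℂ(ℂ)` (`Projectivization.lift`), which is injective.
* The affine charts: `Uᵢ = Spec ℂ[x₀,…,xₙ]_{(xᵢ)}` as a `ℂ`-scheme (`Literature.NumberTheory.Transcendental.chartScheme`, with the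
  `ℂ`-algebra structure `Literature.AlgebraicGeometry.Motives.ProjBaseChange.algebraBase` of the accepted
  `Literature/AlgebraicGeometry/Motives/BaseChangeProofs.lean` on Mathlib's
  `HomogeneousLocalization.Away`) and the open immersion `Literature.chartι n i : Uᵢ ⟶ ℙⁿ_ℂ` over `ℂ`
  (Mathlib `Proj.awayι`; over `Spec ℂ` by `ProjBaseChange.awayι_projToSpec`). `L`-points of
  `Spec R` over `k` are `k`-algebra maps `R →ₐ[k] L`, values of global sections being given by
  application (`Literature.AlgebraicGeometry.Motives.AlgPoints.ofAlgHom`, `toAlgHom`, `eval_ofAlgHom_top`,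
  `pt_ofAlgHom_mem_basicOpen_iff`); the point `Literature.chartPoint n z hz ∈ Uᵢ(ℂ)` (`zᵢ ≠ 0`) is given
  by `g/xᵢᵐ ↦ g(z)/zᵢᵐ` (`Literature.NumberTheory.Transcendental.awayEval`), maps to `pointOfVec n z` (`Literature.NumberTheory.Transcendental.map_chartι_chartPoint`),
  and every point of `Uᵢ(ℂ)` is of this form (`Literature.NumberTheory.Transcendental.chartPoint_surjective`), because
  `ℂ[x₀,…,xₙ]_{(xᵢ)}` is generated by the `xⱼ/xᵢ` (dehomogenization `g/xᵢᵐ = g(x₀/xᵢ,…,xₙ/xᵢ)`,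
  `Literature.NumberTheory.Transcendental.awayMk_eq_aeval_awayCoord`, from the chart isomorphism
  `Literature.ProjectiveSpace.chartAlgEquiv : ℂ[x₀,…,xₙ]_{(xᵢ)} ≃ₐ ℂ[y₁,…,yₙ]` of the accepted
  `Literature/AlgebraicGeometry/Motives/VarietiesProjectiveSpaceProofs.lean`). Since the `D₊(xᵢ)`
  cover `ℙⁿ` (`Literature.AlgebraicGeometry.Motives.ProjectiveSpace.irrelevant_le_span`, `Literature.NumberTheory.Transcendental.exists_pt_mem_basicOpen_X`) and points
  of `D₊(xᵢ)(ℂ)` lift to `Uᵢ(ℂ)` (accepted `AlgPoints.liftOfMemOpensRange`), `projPoint` is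
  surjective.
* Topology (Lemme 1 a), d) and the Remarque): the strong topology of `Uᵢ(ℂ)` is induced by the
  coordinate map `(xⱼ/xᵢ)ⱼ : Uᵢ(ℂ) → ℂⁿ⁺¹` (accepted
  `AlgPoints.exists_isOpen_inter_preimage_subset_basicSet`), whence a continuity criterion into
  `X(L)` (`Literature.AlgebraicGeometry.Motives.AlgPoints.continuous_of_continuous_eval`); so `z ↦ chartPoint n z` is continuous,
  `projPoint` is continuous (chart by chart, then descend along the quotient map), and it is open
  because on `Uᵢ(ℂ)` its inverse is `Q ↦ [chartCoords Q]` (continuous) and `Uᵢ(ℂ) ↪ ℙⁿ_ℂ(ℂ)` is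
  an open embedding (accepted `AlgPoints.isOpenEmbedding_map_holds`). Hence
  `Literature.NumberTheory.Transcendental.isHomeomorph_projPoint`.
* Holomorphy (Lemme 1 c)): a regular function `s ∈ Γ(ℙⁿ, U)` is, on `Uᵢ(ℂ)` near any point, a
  quotient `pa/pgᵐ` of polynomials in the coordinates `xⱼ/xᵢ` with `pg ≠ 0`
  (`Literature.AlgebraicGeometry.Motives.AlgPoints.exists_eval_eq_div`), and in the chart `stdChart i` these coordinates are
  `(w₁, …, 1, …, wₙ)`; polynomials are analytic (`AnalyticAt.aeval_mvPolynomial`), so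
  `s ∘ projPoint ∘ stdChartInv i` is differentiable
  (`Literature.NumberTheory.Transcendental.differentiableAt_evalOrZero_projPoint_stdChartInv`). `MDifferentiableAt` on `ℙⁿ(𝕜)` only
  involves the chart `chartAt p = stdChart i₀` for one `i₀` with `pᵢ₀ ≠ 0`, so differentiability in
  every standard chart containing `p` suffices
  (`Projectivization.mdifferentiableAt_of_differentiableAt_stdChartInv`); no compatibility of the
  atlas is used.
* `Literature.NumberTheory.Transcendental.preimage_projPoint_setOf_pt_mem_basicOpen`: `φ⁻¹(D₊(F)(ℂ)) = V(F)ᶜ` (positive degree: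
  `pt_pointOfVec_mem_basicOpen_iff`; degree `0`: `F` is a nonzero constant, a unit, or `0`).

## Main statements

* `Literature.projPoint n`, `Literature.NumberTheory.Transcendental.isHomeomorph_projPoint`, `Literature.NumberTheory.Transcendental.mdifferentiableOn_evalOrZero_projPoint`,
  `Literature.NumberTheory.Transcendental.isAnalytification_projPoint`, `Literature.NumberTheory.Transcendental.exists_isAnalytification_proj_holds`.
* Of independent use: `Literature.AlgebraicGeometry.Motives.AlgPoints.ofAlgHom`/`toAlgHom` (points of affine `k`-schemes),
  `Literature.AlgebraicGeometry.Motives.AlgPoints.exists_eval_eq_div`, `Literature.AlgebraicGeometry.Motives.AlgPoints.continuous_of_continuous_eval`,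
  `Literature.AlgebraicGeometry.Motives.ComplexPoints.ext_of_pt_eq`,
  `Literature.NumberTheory.Transcendental.Proj.ext_of_forall_mem_basicOpen_iff`,
  `Projectivization.mdifferentiableAt_of_differentiableAt_stdChartInv`.

## References

* J.-P. Serre, *Géométrie algébrique et géométrie analytique*, Ann. Inst. Fourier **6** (1956),
  1–42, doi:10.5802/aif.59, §2 n°5: Lemme 1, Prop. 2 and the Remarque following it (pp. 8–9).
* R. Hartshorne, *Algebraic Geometry*, GTM 52, Springer 1977: II Prop. 2.5 (the standard affine
  cover of `Proj`), II Ex. 2.14, II Thm. 7.1 (morphisms to `ℙⁿ`), II Ex. 2.7 (points with values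
  in a field).
* D. Mumford, *The Red Book of Varieties and Schemes*, I §10 (the complex topology).
* P. Griffiths, J. Harris, *Principles of Algebraic Geometry*, p. 15 (the standard atlas of `ℙⁿ`).
-/

noncomputable section

universe u

open CategoryTheory AlgebraicGeometry Topology TopologicalSpace
open scoped Manifold ContDiff LinearAlgebra.Projectivization

namespace Literature.NumberTheory.Transcendental

/-! ### `L`-points of affine `k`-schemes -/

section AlgPoints
open Literature.AlgebraicGeometry.Motives (AlgPoints)
open Literature.AlgebraicGeometry.Motives.AlgPoints

variable {k : Type u} [Field k] {L : Type u} [Field L] [Algebra k L]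

section SpecPoints

variable {R : Type u} [CommRing R] [Algebra k R]

/-- The `L`-point of the affine `k`-scheme `Spec R` (`R` a `k`-algebra) given by a `k`-algebra map
`e : R →ₐ[k] L`, namely `Spec e : Spec L ⟶ Spec R`. [Hartshorne II Ex. 2.7; EGA I 2.2.4]
[folklore] -/
def _root_.Literature.AlgebraicGeometry.Motives.AlgPoints.ofAlgHom (e : R →ₐ[k] L) : AlgPoints (Literature.AlgebraicGeometry.Motives.specOver k R) L :=
  AlgPoints.mk (Spec.map (CommRingCat.ofHom e.toRingHom)) (by
    change Spec.map _ ≫ Spec.map _ = Spec.map _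
    rw [← Spec.map_comp, ← CommRingCat.ofHom_comp, AlgHom.toRingHom_eq_coe, AlgHom.comp_algebraMap])

/-- The underlying morphism of `ofAlgHom e` is `Spec e`. [Hartshorne II Ex. 2.7] [folklore] -/
@[simp]
theorem _root_.Literature.AlgebraicGeometry.Motives.AlgPoints.toSpecHom_ofAlgHom (e : R →ₐ[k] L) :
    (ofAlgHom e).toSpecHom = Spec.map (CommRingCat.ofHom e.toRingHom) :=
  rfl

/-- The underlying point of `ofAlgHom e` is the kernel of `e`: it lies in `D(r)` iff `e r ≠ 0`.
[Hartshorne II Ex. 2.7] [folklore] -/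
theorem _root_.Literature.AlgebraicGeometry.Motives.AlgPoints.pt_ofAlgHom_mem_basicOpen_iff (e : R →ₐ[k] L) (r : R) :
    (ofAlgHom e).pt ∈ PrimeSpectrum.basicOpen r ↔ e r ≠ 0 := by
  change (Spec.map (CommRingCat.ofHom e.toRingHom)).base (IsLocalRing.closedPoint L) ∈
    PrimeSpectrum.basicOpen r ↔ _
  rw [Spec.map_base]
  change PrimeSpectrum.comap e.toRingHom (IsLocalRing.closedPoint L) ∈ PrimeSpectrum.basicOpen r ↔ _
  rw [PrimeSpectrum.mem_basicOpen, PrimeSpectrum.comap_asIdeal, Ideal.mem_comap]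
  change e r ∉ IsLocalRing.maximalIdeal L ↔ _
  rw [IsLocalRing.maximalIdeal_eq_bot, Ideal.mem_bot]

/-- The value at `ofAlgHom e` of the global section `s ∈ Γ(Spec R, ⊤) = R` is `e s`.
[Hartshorne II Ex. 2.7; Mumford, *Red Book* I §10] [folklore] -/
theorem _root_.Literature.AlgebraicGeometry.Motives.AlgPoints.eval_ofAlgHom_top (e : R →ₐ[k] L) (h : (ofAlgHom e).pt ∈ (⊤ : (Spec (.of R)).Opens))
    (s : Γ(Spec (.of R), ⊤)) :
    (ofAlgHom e).eval ⊤ h s = e ((Scheme.ΓSpecIso (.of R)).hom s) := by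
  rw [eval_eq_stalkClosedPointTo]
  exact (ConcreteCategory.congr_hom
    (Scheme.germ_stalkClosedPointTo_Spec (R := .of R) (CommRingCat.ofHom e.toRingHom)) s : _)

/-- The `k`-algebra map `R →ₐ[k] L` underlying an `L`-point of `Spec R` over `k`: the ring map
`R → L` with `Spec` of it the given morphism (Mathlib `Spec.preimage`), which is `k`-linear by the
`Over` condition. [Hartshorne II Ex. 2.7, Prop. 2.3] [folklore] -/
def _root_.Literature.AlgebraicGeometry.Motives.AlgPoints.toAlgHom (P : AlgPoints (Literature.AlgebraicGeometry.Motives.specOver k R) L) : R →ₐ[k] L where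
  __ := (Spec.preimage P.toSpecHom).hom
  commutes' c := by
    have h₁ : Spec.map (Spec.preimage P.toSpecHom) ≫ Spec.map (CommRingCat.ofHom (algebraMap k R)) =
        Spec.map (CommRingCat.ofHom (algebraMap k L)) := by
      rw [Spec.map_preimage]
      exact Over.w P
    rw [← Spec.map_comp] at h₁
    have h₂ := congrArg (fun f : CommRingCat.of k ⟶ CommRingCat.of L ↦ f.hom c)
      (Spec.map_injective h₁)
    simpa using h₂

/-- Every `L`-point of `Spec R` over `k` is `ofAlgHom` of its underlying algebra map.
[Hartshorne II Ex. 2.7, Prop. 2.3] [folklore] -/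
@[simp]
theorem _root_.Literature.AlgebraicGeometry.Motives.AlgPoints.ofAlgHom_toAlgHom (P : AlgPoints (Literature.AlgebraicGeometry.Motives.specOver k R) L) : ofAlgHom (toAlgHom P) = P := by
  ext : 1
  change Spec.map (CommRingCat.ofHom (Spec.preimage P.toSpecHom).hom) = P.left
  rw [CommRingCat.ofHom_hom, Spec.map_preimage]

/-- `ofAlgHom` is surjective. [Hartshorne II Ex. 2.7] [folklore] -/
theorem _root_.Literature.AlgebraicGeometry.Motives.AlgPoints.ofAlgHom_surjective : Function.Surjective (ofAlgHom (k := k) (L := L) (R := R)) :=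
  fun P ↦ ⟨toAlgHom P, ofAlgHom_toAlgHom P⟩

end SpecPoints

end AlgPoints

/-! ### Complex points are determined by their underlying point -/

section ComplexPoints
open Literature.AlgebraicGeometry.Motives (ComplexPoints)
open Literature.AlgebraicGeometry.Motives.ComplexPoints

/-- For `X` locally of finite type over `ℂ`, a complex point is determined by its underlying
(closed) point (Nullstellensatz: `equivClosedPoints`). [Mumford, *Red Book* I §10] [folklore] -/
theorem _root_.Literature.AlgebraicGeometry.Motives.ComplexPoints.ext_of_pt_eq {X : Literature.AlgebraicGeometry.Motives.SchemeOver ℂ} [LocallyOfFiniteType X.hom] {P Q : ComplexPoints X}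
    (h : P.pt = Q.pt) : P = Q :=
  (equivClosedPoints X).injective (Subtype.ext h)

end ComplexPoints

/-! ### Regular functions in affine coordinates: local rational representation, continuity test -/

section AlgPoints
open Literature.AlgebraicGeometry.Motives (AlgPoints)
open Literature.AlgebraicGeometry.Motives.AlgPoints

variable {k : Type u} [Field k] {X : Literature.AlgebraicGeometry.Motives.SchemeOver k} {L : Type u} [Field L] [Algebra k L]

/-- **Local rational representation of regular functions in affine coordinates.** Let `Uₐ ⊆ X`
be an affine open with sections `x₁, …, x_N ∈ Γ(X, Uₐ)` such that every `a ∈ Γ(X, Uₐ)` is, on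
`Uₐ(L)`, a polynomial in the functions `xⱼ` (e.g. generators of `Γ(X, Uₐ)`), and let `Φ` be the
coordinate map. For any open `U`, `f ∈ Γ(X, U)` and `P ∈ U(L) ∩ Uₐ(L)` there are polynomials
`pa`, `pg` and `m` with `pg(Φ P) ≠ 0` such that on `{Q ∈ Uₐ(L) | pg(Φ Q) ≠ 0} ⊆ U(L)` one has
`f(Q) = pa(Φ Q) / pg(Φ Q)ᵐ`: shrink to a basic open `D(g) ⊆ U ∩ Uₐ` of `Uₐ`
(`IsAffineOpen.exists_basicOpen_le`) and write `f|D(g) = a/gᵐ`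
(`IsAffineOpen.isLocalization_basicOpen`). This is the computation behind Serre's Lemme 1 c)
(«toute fonction régulière sur U est holomorphe, ce qui résulte encore du fait qu'un polynôme est
une fonction holomorphe»). [cite: SerreGAGA1956, §2 n°5 Lemme 1 c)] -/
theorem _root_.Literature.AlgebraicGeometry.Motives.AlgPoints.exists_eval_eq_div {Ua : X.left.Opens} (hUa : IsAffineOpen Ua)
    {N : ℕ} (x : Fin N → Γ(X.left, Ua))
    (hx : ∀ a : Γ(X.left, Ua), ∃ p : MvPolynomial (Fin N) L, ∀ (Q : AlgPoints X L)
      (h : Q.pt ∈ Ua), Q.eval Ua h a = MvPolynomial.eval (fun j ↦ Q.eval Ua h (x j)) p)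
    (U : X.left.Opens) (f : Γ(X.left, U)) {P : AlgPoints X L} (hPU : P.pt ∈ U) (hPa : P.pt ∈ Ua) :
    ∃ (pa pg : MvPolynomial (Fin N) L) (m : ℕ),
      MvPolynomial.eval (fun j ↦ evalOrZero Ua (x j) P) pg ≠ 0 ∧
      ∀ Q : AlgPoints X L, Q.pt ∈ Ua →
        MvPolynomial.eval (fun j ↦ evalOrZero Ua (x j) Q) pg ≠ 0 →
        ∃ hQ : Q.pt ∈ U, Q.eval U hQ f =
          MvPolynomial.eval (fun j ↦ evalOrZero Ua (x j) Q) pa /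
            MvPolynomial.eval (fun j ↦ evalOrZero Ua (x j) Q) pg ^ m := by
  -- a basic open `D(g) ⊆ U ∩ Uₐ` of `Uₐ` around `P.pt`
  obtain ⟨g, hgle, hPg⟩ :=
    hUa.exists_basicOpen_le (V := U ⊓ Ua) ⟨P.pt, Opens.mem_inf.mpr ⟨hPU, hPa⟩⟩ hPa
  -- `f|D(g) = a / g ^ m`
  have := hUa.isLocalization_basicOpen g
  obtain ⟨⟨a, ⟨_, m, rfl⟩⟩, hfa⟩ := IsLocalization.surj (Submonoid.powers g)
    (X.left.presheaf.map (homOfLE (hgle.trans inf_le_left)).op f)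
  obtain ⟨pa, hpa⟩ := hx a
  obtain ⟨pg, hpg⟩ := hx g
  -- the coordinate map on `Uₐ(L)`
  have hΦ : ∀ (Q : AlgPoints X L) (hQ : Q.pt ∈ Ua),
      (fun j ↦ evalOrZero Ua (x j) Q) = fun j ↦ Q.eval Ua hQ (x j) :=
    fun Q hQ ↦ funext fun j ↦ evalOrZero_of_mem _ hQ
  -- `Q.pt ∈ D(g)` iff `pg (Φ Q) ≠ 0`
  have hmem : ∀ (Q : AlgPoints X L) (hQ : Q.pt ∈ Ua),
      Q.pt ∈ X.left.basicOpen g ↔ MvPolynomial.eval (fun j ↦ evalOrZero Ua (x j) Q) pg ≠ 0 := by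
    intro Q hQ
    rw [hΦ Q hQ, ← hpg Q hQ, eval_ne_zero_iff_mem_basicOpen]
  refine ⟨pa, pg, m, (hmem P hPa).mp hPg, fun Q hQa hQg ↦ ?_⟩
  have hQ : Q.pt ∈ X.left.basicOpen g := (hmem Q hQa).mpr hQg
  refine ⟨(Opens.mem_inf.mp (hgle hQ)).1, ?_⟩
  have hg0 : Q.eval Ua hQa g ≠ 0 := (Q.eval_ne_zero_iff_mem_basicOpen Ua hQa g).mpr hQ
  -- evaluation at `Q` as a ring homomorphism `Γ(X, D(g)) →+* L`
  let ε : Γ(X.left, X.left.basicOpen g) →+* L :=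
    (X.left.evaluation (X.left.basicOpen g) Q.pt hQ ≫ Q.resHom).hom
  have hε : ∀ f', ε f' = Q.eval (X.left.basicOpen g) hQ f' := fun _ ↦ rfl
  have key := congrArg ε hfa
  simp only [map_mul, map_pow] at key
  simp only [hε, eval_algebraMap_basicOpen] at key
  rw [eval_map_homOfLE] at key
  rw [hΦ Q hQa, ← hpa Q hQa, ← hpg Q hQa, eq_div_iff (pow_ne_zero m hg0)]
  exact key

variable [TopologicalSpace L] [IsTopologicalDivisionRing L] [T1Space L]

/-- **Continuity into `X(L)` is tested on affine coordinates.** With `Uₐ`, `xⱼ` as in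
`exists_eval_eq_div`, a map `g : T → X(L)` with image in `Uₐ(L)` is continuous for the strong
topology as soon as its coordinates `t ↦ xⱼ(g t)` are continuous: the strong topology on `Uₐ(L)`
is induced by the coordinate map (`exists_isOpen_inter_preimage_subset_basicSet`, i.e. Serre's
Lemme 1: a chart is a Z-locally-closed subset of `Lᴺ` with the induced topology).
[cite: SerreGAGA1956, §2 n°5 Lemme 1 and Remarque] -/
theorem _root_.Literature.AlgebraicGeometry.Motives.AlgPoints.continuous_of_continuous_eval {T : Type*} [TopologicalSpace T] {Ua : X.left.Opens}
    (hUa : IsAffineOpen Ua) {N : ℕ} (x : Fin N → Γ(X.left, Ua))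
    (hx : ∀ a : Γ(X.left, Ua), ∃ p : MvPolynomial (Fin N) L, ∀ (Q : AlgPoints X L)
      (h : Q.pt ∈ Ua), Q.eval Ua h a = MvPolynomial.eval (fun j ↦ Q.eval Ua h (x j)) p)
    (g : T → AlgPoints X L) (hg : ∀ t, (g t).pt ∈ Ua)
    (hc : Continuous fun t j ↦ (g t).eval Ua (hg t) (x j)) : Continuous g := by
  refine continuous_generateFrom_iff.mpr ?_
  rintro _ ⟨U, f, V, hV, rfl⟩
  rw [isOpen_iff_forall_mem_open]
  intro t ht
  obtain ⟨W, hW, htW, hWsub⟩ := exists_isOpen_inter_preimage_subset_basicSet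
    hUa x hx U f hV ht (hg t)
  have hΦ : ∀ t', (fun j ↦ evalOrZero Ua (x j) (g t')) = fun j ↦ (g t').eval Ua (hg t') (x j) :=
    fun t' ↦ funext fun j ↦ evalOrZero_of_mem _ (hg t')
  refine ⟨(fun t' j ↦ (g t').eval Ua (hg t') (x j)) ⁻¹' W, fun t' ht' ↦ hWsub ⟨hg t', ?_⟩,
    hW.preimage hc, ?_⟩
  · simpa only [Set.mem_preimage, hΦ t'] using ht'
  · simpa only [Set.mem_preimage, hΦ t] using htW

end AlgPoints

/-! ### Points of `Proj` are determined by the basic opens `D₊(f)`, `deg f > 0`, containing them -/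

/-- Two points of `Proj A` lying in the same basic open sets `D₊(f)` for all homogeneous `f` of
positive degree are equal: a relevant homogeneous prime `𝔭` is determined by its homogeneous
elements of positive degree (if `f ∉ 𝔭` has positive degree, then for `a ∈ A₀`,
`a ∈ 𝔭 ↔ a f ∈ 𝔭`). [EGA II 2.3; Hartshorne II §2] [folklore] -/
theorem Proj.ext_of_forall_mem_basicOpen_iff {A σ : Type*} [CommRing A] [SetLike σ A]
    [AddSubgroupClass σ A] (𝒜 : ℕ → σ) [GradedRing 𝒜] {x y : Proj 𝒜}
    (h : ∀ ⦃m : ℕ⦄, 0 < m → ∀ f ∈ 𝒜 m, (x ∈ Proj.basicOpen 𝒜 f ↔ y ∈ Proj.basicOpen 𝒜 f)) :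
    x = y := by
  classical
  -- a homogeneous element of positive degree not in `x`
  obtain ⟨e, he, f₀, hf₀, hf₀x⟩ : ∃ e, 0 < e ∧ ∃ f₀ ∈ 𝒜 e, f₀ ∉ x.asHomogeneousIdeal := by
    by_contra! H
    refine x.not_irrelevant_le fun a ha ↦ ?_
    rw [← HomogeneousIdeal.mem_iff, x.asHomogeneousIdeal.isHomogeneous.mem_iff]
    intro i
    rcases Nat.eq_zero_or_pos i with rfl | hi
    · have : ((DirectSum.decompose 𝒜 a 0 : A)) = 0 := by
        rw [← GradedRing.proj_apply]; exact (HomogeneousIdeal.mem_irrelevant_iff 𝒜 a).mp ha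
      rw [this]; exact zero_mem _
    · exact H i hi _ (SetLike.coe_mem _)
  have hf₀y : f₀ ∉ y.asHomogeneousIdeal :=
    (Proj.mem_basicOpen 𝒜 f₀ y).mp ((h he f₀ hf₀).mp hf₀x)
  refine ProjectiveSpectrum.ext (HomogeneousIdeal.ext (Ideal.ext fun a ↦ ?_))
  rw [x.asHomogeneousIdeal.isHomogeneous.mem_iff, y.asHomogeneousIdeal.isHomogeneous.mem_iff]
  refine forall_congr' fun i ↦ ?_
  rcases Nat.eq_zero_or_pos i with rfl | hi
  · -- degree `0`: `a₀ ∈ 𝔭 ↔ a₀ f₀ ∈ 𝔭`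
    set a₀ : A := (DirectSum.decompose 𝒜 a 0 : A)
    have hmem : a₀ * f₀ ∈ 𝒜 e := by
      simpa using SetLike.mul_mem_graded (SetLike.coe_mem (DirectSum.decompose 𝒜 a 0)) hf₀
    have key : ∀ z : Proj 𝒜, f₀ ∉ z.asHomogeneousIdeal →
        (a₀ ∈ z.asHomogeneousIdeal.toIdeal ↔ a₀ * f₀ ∈ z.asHomogeneousIdeal.toIdeal) := by
      intro z hz
      refine ⟨fun ha ↦ Ideal.mul_mem_right _ _ ha, fun ha ↦ ?_⟩
      exact ((z.isPrime.mem_or_mem ha).resolve_right fun hf ↦ hz hf)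
    rw [key x hf₀x, key y hf₀y]
    have := h he _ hmem
    simp only [Proj.mem_basicOpen] at this
    rw [HomogeneousIdeal.mem_iff, HomogeneousIdeal.mem_iff]
    tauto
  · have := h hi _ (SetLike.coe_mem (DirectSum.decompose 𝒜 a i))
    simp only [Proj.mem_basicOpen] at this
    rw [HomogeneousIdeal.mem_iff, HomogeneousIdeal.mem_iff]
    tauto

/-! ### Preliminaries: differentiability on `ℙⁿ(𝕜)` chart by chart, polynomials are analytic -/

/-- On `ℙⁿ(𝕜)` with its standard atlas, a function is `MDifferentiableAt` a point `p` as soon as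
it is continuous at `p` and differentiable, in each standard chart `Uᵢ ∋ p`, at the coordinates
of `p` (the definition of `MDifferentiableAt` uses one particular chart at `p`; no compatibility of
charts is needed). Deliberately placed in Mathlib's `Projectivization` namespace, like the atlas
`Projectivization.instChartedSpace` of `Literature.NumberTheory.Transcendental.ProjectiveSpace`.
[Griffiths–Harris, p. 15] [folklore] -/
theorem _root_.Projectivization.mdifferentiableAt_of_differentiableAt_stdChartInv {𝕜 : Type*}
    [NontriviallyNormedField 𝕜] {n : ℕ} {F : Type*} [NormedAddCommGroup F] [NormedSpace 𝕜 F]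
    {f : ℙ 𝕜 (Fin (n + 1) → 𝕜) → F} {p : ℙ 𝕜 (Fin (n + 1) → 𝕜)} (hc : ContinuousAt f p)
    (hd : ∀ i, p.rep i ≠ 0 → DifferentiableAt 𝕜 (fun w ↦ f (Projectivization.stdChartInv i w))
      (Projectivization.stdChartFun i p)) :
    MDifferentiableAt 𝓘(𝕜, Fin n → 𝕜) 𝓘(𝕜, F) f p := by
  rw [mdifferentiableAt_iff]
  refine ⟨hc, ?_⟩
  simp only [writtenInExtChartAt, extChartAt_coe, extChartAt_coe_symm, modelWithCornersSelf_coe,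
    modelWithCornersSelf_coe_symm, Function.comp_id, Function.id_comp, Set.range_id,
    Projectivization.chartAt_eq, chartAt_self_eq, differentiableWithinAt_univ,
    OpenPartialHomeomorph.refl_apply, Projectivization.stdChart_apply]
  exact hd _ (Classical.choose_spec (Projectivization.exists_rep_apply_ne_zero p))

/-- Polynomials in the affine coordinates `(w₁, …, 1, …, wₙ)` (a `1` inserted in position `i`)
are analytic functions of `w ∈ ℂⁿ`. [folklore] -/
theorem analyticAt_eval_insertNth {n : ℕ} (i : Fin (n + 1)) (p : MvPolynomial (Fin (n + 1)) ℂ)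
    (w₀ : Fin n → ℂ) :
    AnalyticAt ℂ (fun w : Fin n → ℂ ↦ MvPolynomial.eval (Fin.insertNth i (1 : ℂ) w) p) w₀ := by
  have key := AnalyticAt.aeval_mvPolynomial (𝕜 := ℂ) (A := ℂ) (B := ℂ) (z := w₀)
    (f := fun w : Fin n → ℂ ↦ Fin.insertNth i (1 : ℂ) w) (fun k ↦ ?_) p
  · simp only [MvPolynomial.aeval_eq_eval] at key
    exact key
  · refine Fin.succAboveCases i ?_ (fun j ↦ ?_) k
    · simp only [Fin.insertNth_apply_same]
      exact analyticAt_const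
    · simp only [Fin.insertNth_apply_succAbove]
      exact (ContinuousLinearMap.proj (R := ℂ) (φ := fun _ : Fin n ↦ ℂ) j).analyticAt w₀

/-! ### Complex points of `ℙⁿ_ℂ` with given homogeneous coordinates -/

section Proj

open MvPolynomial HomogeneousLocalization Projectivization

attribute [local instance] MvPolynomial.gradedAlgebra Literature.AlgebraicGeometry.Motives.ProjBaseChange.algebraBase

variable (n : ℕ)

/-- The grading of `ℂ[x₀, …, xₙ]` by degree, `𝓐 = MvPolynomial.homogeneousSubmodule (Fin (n + 1)) ℂ`
(local notation; `ℙⁿ_ℂ = Proj 𝓐`). [folklore] -/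
local notation "𝓐" => MvPolynomial.homogeneousSubmodule (Fin (n + 1)) ℂ


/-- The ring map `F ↦ F(z)` from `ℂ[x₀, …, xₙ]` to `Γ(Spec ℂ, ⊤) = ℂ`. [folklore] -/
def evalToΓ (z : Fin (n + 1) → ℂ) : MvPolynomial (Fin (n + 1)) ℂ →+* Γ(Spec (.of ℂ), ⊤) :=
  (Scheme.ΓSpecIso (.of ℂ)).commRingCatIsoToRingEquiv.symm.toRingHom.comp (MvPolynomial.eval z)

/-- `evalToΓ n z F` is `F(z)` transported to `Γ(Spec ℂ, ⊤)` along `ΓSpecIso`. [folklore] -/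
theorem evalToΓ_apply (z : Fin (n + 1) → ℂ) (F : MvPolynomial (Fin (n + 1)) ℂ) :
    evalToΓ n z F = (Scheme.ΓSpecIso (.of ℂ)).inv (MvPolynomial.eval z F) := rfl

/-- For `z ≠ 0` the irrelevant ideal `(x₀, …, xₙ)` generates the unit ideal after evaluation at
`z` (some `zᵢ` is a unit): the hypothesis of Mathlib's `Proj.fromOfGlobalSections`.
[Hartshorne II Thm. 7.1] [folklore] -/
theorem irrelevant_map_evalToΓ (z : Fin (n + 1) → ℂ) (hz : z ≠ 0) :
    (HomogeneousIdeal.irrelevant 𝓐).toIdeal.map (evalToΓ n z) = ⊤ := by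
  obtain ⟨i, hi⟩ := Function.ne_iff.mp hz
  refine Ideal.eq_top_of_isUnit_mem _ (Ideal.mem_map_of_mem _ (x := X i) ?_) ?_
  · rw [HomogeneousIdeal.mem_iff, HomogeneousIdeal.mem_irrelevant_iff, GradedRing.proj_apply,
      DirectSum.decompose_of_mem_ne 𝓐 (isHomogeneous_X ℂ i) one_ne_zero]
  · rw [evalToΓ_apply, eval_X]
    exact (Ne.isUnit hi).map _

/-- The morphism `Spec ℂ ⟶ ℙⁿ_ℂ = Proj ℂ[x₀, …, xₙ]` with homogeneous coordinates `z ≠ 0`: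
Mathlib's `Proj.fromOfGlobalSections` for the ring map `F ↦ F(z)` (a morphism `T ⟶ Proj A` from a
ring map `A → Γ(T, 𝒪_T)` under which the irrelevant ideal generates the unit ideal).
[Hartshorne II Thm. 7.1] [folklore] -/
def toSpecHomOfVec (z : Fin (n + 1) → ℂ) (hz : z ≠ 0) : Spec (.of ℂ) ⟶ Proj 𝓐 :=
  Proj.fromOfGlobalSections 𝓐 (evalToΓ n z) (irrelevant_map_evalToΓ n z hz)

/-- The morphism `Spec ℂ ⟶ ℙⁿ_ℂ` with homogeneous coordinates `z` is a morphism over `Spec ℂ`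
(Mathlib `Proj.fromOfGlobalSections_toSpecZero`). [Hartshorne II Thm. 7.1] [folklore] -/
theorem toSpecHomOfVec_comp_hom (z : Fin (n + 1) → ℂ) (hz : z ≠ 0) :
    toSpecHomOfVec n z hz ≫ (Proj.toSpecZero 𝓐 ≫
      Spec.map (CommRingCat.ofHom (algebraMap ℂ (𝓐 0)))) =
      Spec.map (CommRingCat.ofHom (algebraMap ℂ ℂ)) := by
  rw [Algebra.algebraMap_self, CommRingCat.ofHom_id, Spec.map_id,
    toSpecHomOfVec, Proj.fromOfGlobalSections_toSpecZero_assoc, ← Spec.map_comp,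
    ← CommRingCat.ofHom_comp, RingHom.comp_assoc]
  have : (algebraMap (𝓐 0) (MvPolynomial (Fin (n + 1)) ℂ)).comp (algebraMap ℂ (𝓐 0)) =
      MvPolynomial.C := by
    rw [← IsScalarTower.algebraMap_eq, MvPolynomial.algebraMap_eq]
  rw [this]
  have : (evalToΓ n z).comp C = (Scheme.ΓSpecIso (.of ℂ)).inv.hom := by
    ext c
    simp [evalToΓ_apply]
  rw [this, CommRingCat.ofHom_hom, ← Scheme.isoSpec_Spec_inv, ← Scheme.isoSpec_hom,
    Iso.hom_inv_id]

/-- The complex point of `ℙⁿ_ℂ` (over `ℂ`) with homogeneous coordinates `z ≠ 0`.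
[Hartshorne II Ex. 2.14, Thm. 7.1] [folklore] -/
def pointOfVec (z : Fin (n + 1) → ℂ) (hz : z ≠ 0) : Literature.AlgebraicGeometry.Motives.ComplexPoints (Literature.AlgebraicGeometry.Motives.projectiveSpace n ℂ) :=
  Literature.AlgebraicGeometry.Motives.AlgPoints.mk (toSpecHomOfVec n z hz) (toSpecHomOfVec_comp_hom n z hz)

/-- The underlying point of `pointOfVec n z hz` (definitional unfolding). [folklore] -/
theorem pt_pointOfVec (z : Fin (n + 1) → ℂ) (hz : z ≠ 0) :
    (pointOfVec n z hz).pt = (toSpecHomOfVec n z hz).base (IsLocalRing.closedPoint ℂ) := rfl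

/-- **The point with homogeneous coordinates `z` lies in `D₊(F)` iff `F(z) ≠ 0`**, for `F`
homogeneous of positive degree (Mathlib `Proj.fromOfGlobalSections_preimage_basicOpen`).
[Hartshorne II §2, Prop. 2.5 and Thm. 7.1] [folklore] -/
theorem pt_pointOfVec_mem_basicOpen_iff (z : Fin (n + 1) → ℂ) (hz : z ≠ 0) {m : ℕ} (hm : 0 < m)
    {F : MvPolynomial (Fin (n + 1)) ℂ} (hF : F ∈ 𝓐 m) :
    (pointOfVec n z hz).pt ∈ Proj.basicOpen 𝓐 F ↔ MvPolynomial.eval z F ≠ 0 := by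
  rw [pt_pointOfVec]
  change IsLocalRing.closedPoint ℂ ∈ toSpecHomOfVec n z hz ⁻¹ᵁ Proj.basicOpen 𝓐 F ↔ _
  rw [toSpecHomOfVec, Proj.fromOfGlobalSections_preimage_basicOpen 𝓐 _ _ hm hF, evalToΓ_apply,
    basicOpen_eq_of_affine]
  change IsLocalRing.closedPoint ℂ ∈ PrimeSpectrum.basicOpen _ ↔ _
  rw [PrimeSpectrum.mem_basicOpen]
  change _ ∉ IsLocalRing.maximalIdeal ℂ ↔ _
  rw [IsLocalRing.maximalIdeal_eq_bot, Ideal.mem_bot]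

/-! ### The affine charts `Uᵢ = D₊(xᵢ) = Spec ℂ[x₀, …, xₙ]_{(xᵢ)}` -/

section Charts


variable (i : Fin (n + 1))

/-- The affine chart scheme `Uᵢ = D₊(xᵢ) ≅ Spec ℂ[x₀,…,xₙ]_{(xᵢ)}` of `ℙⁿ_ℂ`, as a `ℂ`-scheme.
[Hartshorne II Prop. 2.5] [folklore] -/
abbrev chartScheme : Literature.AlgebraicGeometry.Motives.SchemeOver ℂ := Literature.AlgebraicGeometry.Motives.specOver ℂ (Away 𝓐 (X i))

/-- The open immersion `Uᵢ ⟶ ℙⁿ_ℂ` over `ℂ` (Mathlib `Proj.awayι`, `Proj.awayι_toSpecZero`).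
[Hartshorne II Prop. 2.5] [folklore] -/
def chartι : chartScheme n i ⟶ Literature.AlgebraicGeometry.Motives.projectiveSpace n ℂ :=
  Over.homMk (Proj.awayι 𝓐 (X i) (Literature.AlgebraicGeometry.Motives.ProjectiveSpace.X_mem i) one_pos)
    (Literature.AlgebraicGeometry.Motives.ProjBaseChange.awayι_projToSpec (Fin (n + 1)) (Literature.AlgebraicGeometry.Motives.ProjectiveSpace.X_mem i) one_pos)

/-- The underlying morphism of schemes of `chartι n i` is Mathlib's `Proj.awayι`. [folklore] -/
@[simp]
theorem chartι_left : (chartι n i).left =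
    Proj.awayι 𝓐 (X i) (Literature.AlgebraicGeometry.Motives.ProjectiveSpace.X_mem i) one_pos := rfl

/-- `Uᵢ ⟶ ℙⁿ_ℂ` is an open immersion. [Hartshorne II Prop. 2.5] [folklore] -/
instance isOpenImmersion_chartι_left : IsOpenImmersion (chartι n i).left :=
  (inferInstance :
    IsOpenImmersion (Proj.awayι 𝓐 (X i) (Literature.AlgebraicGeometry.Motives.ProjectiveSpace.X_mem i) one_pos))

/-- The image of `Uᵢ ⟶ ℙⁿ_ℂ` is `D₊(xᵢ)`. [Hartshorne II Prop. 2.5] [folklore] -/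
theorem opensRange_chartι_left : (chartι n i).left.opensRange = Proj.basicOpen 𝓐 (X i) :=
  Proj.opensRange_awayι 𝓐 (X i) _ one_pos

/-- A complex point of the chart `Uᵢ` maps into `D₊(g)` iff it lies in the basic open of
`g / xᵢ^{deg g}` (Mathlib `Proj.awayι_preimage_basicOpen`). [Hartshorne II Prop. 2.5] [folklore] -/
theorem pt_map_chartι_mem_basicOpen_iff (Q : Literature.AlgebraicGeometry.Motives.ComplexPoints (chartScheme n i)) {m : ℕ} (hm : 0 < m)
    {g : MvPolynomial (Fin (n + 1)) ℂ} (hg : g ∈ 𝓐 m) :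
    (Literature.AlgebraicGeometry.Motives.AlgPoints.map (chartι n i) Q).pt ∈ Proj.basicOpen 𝓐 g ↔
      Q.pt ∈ PrimeSpectrum.basicOpen
        (Away.isLocalizationElem (𝒜 := 𝓐) (Literature.AlgebraicGeometry.Motives.ProjectiveSpace.X_mem i) hg) := by
  have key := Proj.awayι_preimage_basicOpen 𝓐 (Literature.AlgebraicGeometry.Motives.ProjectiveSpace.X_mem i) one_pos hg hm
  exact (SetLike.ext_iff.mp key) Q.pt

/-! #### Coordinates on the chart `Uᵢ` -/

/-- The affine coordinate `xⱼ/xᵢ ∈ ℂ[x₀,…,xₙ]_{(xᵢ)}` (`j : Fin (n + 1)`; for `j ≠ i` these are the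
chart generators `Literature.AlgebraicGeometry.Motives.ProjectiveSpace.chartGen` of
`Literature.AlgebraicGeometry.Motives.VarietiesProjectiveSpaceProofs`, see `awayCoord_succAbove`,
and `xᵢ/xᵢ = 1`). [Hartshorne II Prop. 2.5, proof] [folklore] -/
def awayCoord (j : Fin (n + 1)) : Away 𝓐 (X i) :=
  Away.mk 𝓐 (Literature.AlgebraicGeometry.Motives.ProjectiveSpace.X_mem i) 1 (X j) (by simpa using Literature.AlgebraicGeometry.Motives.ProjectiveSpace.X_mem j)

/-- `xⱼ/xᵢ` in the localization `ℂ[x₀,…,xₙ]_{xᵢ}`. [folklore] -/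
theorem val_awayCoord (j : Fin (n + 1)) :
    (awayCoord n i j).val =
      Localization.mk (X j) ⟨X i ^ 1, pow_mem (Submonoid.mem_powers _) 1⟩ := by
  simp [awayCoord]

/-- `xᵢ/xᵢ = 1`. [folklore] -/
@[simp]
theorem awayCoord_self : awayCoord n i i = 1 := by
  refine val_injective _ ?_
  rw [val_awayCoord, val_one]
  convert Localization.mk_self
    (⟨X i ^ 1, pow_mem (Submonoid.mem_powers _) 1⟩ : Submonoid.powers (X i : MvPolynomial _ ℂ))
  exact (pow_one _).symm

/-- For `j ≠ i`, written `j = i.succAbove j'`, the coordinate `xⱼ/xᵢ` is the chart generator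
`ProjectiveSpace.chartGen ℂ i j'` of the accepted `VarietiesProjectiveSpaceProofs` (`rfl`).
[folklore] -/
@[simp]
theorem awayCoord_succAbove (j : Fin n) :
    awayCoord n i (i.succAbove j) = Literature.AlgebraicGeometry.Motives.ProjectiveSpace.chartGen ℂ i j := rfl

/-- The family `(xⱼ/xᵢ)ⱼ` is `(x_{i.succAbove j'}/xᵢ)_{j'}` with `1` inserted in the `i`-th slot.
[folklore] -/
theorem awayCoord_eq_insertNth :
    awayCoord n i = Fin.insertNth i 1 (Literature.AlgebraicGeometry.Motives.ProjectiveSpace.chartGen ℂ i) := by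
  funext j
  rcases Fin.eq_self_or_eq_succAbove i j with rfl | ⟨j, rfl⟩ <;> simp

/-- **Dehomogenization.** In `ℂ[x₀,…,xₙ]_{(xᵢ)}`, `g / xᵢᵐ = g(x₀/xᵢ, …, xₙ/xᵢ)` for `g`
homogeneous of degree `m` (so `ℂ[x₀,…,xₙ]_{(xᵢ)}` is generated by the `xⱼ/xᵢ`). This is the
identity `toChart (ofChart (g/xᵢᵐ)) = g/xᵢᵐ` of the accepted chart isomorphism
`ProjectiveSpace.chartAlgEquiv : ℂ[x₀,…,xₙ]_{(xᵢ)} ≃ₐ ℂ[y₁,…,yₙ]`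
(`ProjectiveSpace.toChart_ofChart`, `ofChartRingHom_mk`: `ofChart (g/xᵢᵐ) = g(xᵢ := 1)`).
[Hartshorne I Thm. 3.4 (proof), II Prop. 2.5 (proof)] [folklore] -/
theorem awayMk_eq_aeval_awayCoord {m : ℕ} (g : MvPolynomial (Fin (n + 1)) ℂ) (hg : g ∈ 𝓐 (m • 1)) :
    Away.mk 𝓐 (Literature.AlgebraicGeometry.Motives.ProjectiveSpace.X_mem i) m g hg =
      MvPolynomial.aeval (awayCoord n i) g := by
  rw [← Literature.AlgebraicGeometry.Motives.ProjectiveSpace.toChart_ofChart i (Away.mk 𝓐 (Literature.AlgebraicGeometry.Motives.ProjectiveSpace.X_mem i) m g hg)]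
  change Literature.AlgebraicGeometry.Motives.ProjectiveSpace.toChart ℂ i (Literature.AlgebraicGeometry.Motives.ProjectiveSpace.ofChartRingHom ℂ i _) = _
  rw [Literature.AlgebraicGeometry.Motives.ProjectiveSpace.ofChartRingHom_mk, Literature.AlgebraicGeometry.Motives.ProjectiveSpace.dehomogenize, Literature.AlgebraicGeometry.Motives.ProjectiveSpace.toChart,
    ← AlgHom.comp_apply, MvPolynomial.comp_aeval, awayCoord_eq_insertNth]
  refine DFunLike.congr_fun (congrArg MvPolynomial.aeval (funext fun s ↦ ?_)) g
  rcases Fin.eq_self_or_eq_succAbove i s with rfl | ⟨j, rfl⟩ <;> simp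

/-- A `ℂ`-algebra map `e : ℂ[x₀,…,xₙ]_{(xᵢ)} → ℂ` takes on `g / xᵢᵐ` the value `g(e(x₀/xᵢ), …)`.
[folklore] -/
theorem algHom_awayMk_eq_eval (e : Away 𝓐 (X i) →ₐ[ℂ] ℂ) {m : ℕ}
    (g : MvPolynomial (Fin (n + 1)) ℂ) (hg : g ∈ 𝓐 (m • 1)) :
    e (Away.mk 𝓐 (Literature.AlgebraicGeometry.Motives.ProjectiveSpace.X_mem i) m g hg) =
      MvPolynomial.eval (fun j ↦ e (awayCoord n i j)) g := by
  rw [awayMk_eq_aeval_awayCoord, ← MvPolynomial.aeval_eq_eval, ← AlgHom.comp_apply,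
    MvPolynomial.comp_aeval]

variable {i}

/-- The `ℂ`-algebra map `ℂ[x₀,…,xₙ]_{(xᵢ)} → ℂ`, `g/xᵢᵐ ↦ g(z)/zᵢᵐ`, for `zᵢ ≠ 0` (evaluation at
`z` extends to the localization at `xᵢ`, Mathlib `Localization.awayLift`; `ℂ`-linear by
`ProjBaseChange.val_algebraMap`). [Mumford, *Red Book* I §10] [folklore] -/
def awayEval (z : Fin (n + 1) → ℂ) (hz : z i ≠ 0) : Away 𝓐 (X i) →ₐ[ℂ] ℂ where
  __ := (Localization.awayLift (MvPolynomial.eval z) (X i) (by simpa using Ne.isUnit hz)).comp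
    (algebraMap (Away 𝓐 (X i))
      (Localization (Submonoid.powers (X i : MvPolynomial (Fin (n + 1)) ℂ))))
  commutes' c := by
    simp only [RingHom.toMonoidHom_eq_coe, OneHom.toFun_eq_coe, MonoidHom.toOneHom_coe,
      MonoidHom.coe_coe, RingHom.coe_comp, Function.comp_apply]
    rw [HomogeneousLocalization.algebraMap_apply, Literature.AlgebraicGeometry.Motives.ProjBaseChange.val_algebraMap,
      IsScalarTower.algebraMap_apply ℂ (MvPolynomial (Fin (n + 1)) ℂ) (Localization.Away (X i)),
      Localization.awayLift, IsLocalization.Away.lift_eq, MvPolynomial.algebraMap_eq,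
      MvPolynomial.eval_C]
    rfl

/-- `awayEval` is evaluation at `z` on the localization, restricted to degree `0`
(definitional unfolding). [folklore] -/
theorem awayEval_apply (z : Fin (n + 1) → ℂ) (hz : z i ≠ 0) (q : Away 𝓐 (X i)) :
    awayEval n z hz q =
      Localization.awayLift (MvPolynomial.eval z) (X i : MvPolynomial (Fin (n + 1)) ℂ)
        (by simpa using Ne.isUnit hz) q.val :=
  rfl

/-- `awayEval n z hz (g/xᵢᵐ) = g(z)/zᵢᵐ`. [folklore] -/
theorem awayEval_awayMk (z : Fin (n + 1) → ℂ) (hz : z i ≠ 0) {m : ℕ}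
    (g : MvPolynomial (Fin (n + 1)) ℂ) (hg : g ∈ 𝓐 (m • 1)) :
    awayEval n z hz (Away.mk 𝓐 (Literature.AlgebraicGeometry.Motives.ProjectiveSpace.X_mem i) m g hg) =
      MvPolynomial.eval z g / z i ^ m := by
  rw [awayEval_apply, Away.val_mk, Localization.awayLift_mk (v := (z i)⁻¹) (hv := by simp [hz]),
    inv_pow, div_eq_mul_inv]

/-- `awayEval n z hz (xⱼ/xᵢ) = zⱼ/zᵢ`. [folklore] -/
@[simp]
theorem awayEval_awayCoord (z : Fin (n + 1) → ℂ) (hz : z i ≠ 0) (j : Fin (n + 1)) :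
    awayEval n z hz (awayCoord n i j) = z j / z i := by
  rw [awayCoord, awayEval_awayMk, MvPolynomial.eval_X, pow_one]

/-- The complex point of the chart `Uᵢ` with homogeneous coordinates `z`, `zᵢ ≠ 0`.
[Mumford, *Red Book* I §10] [folklore] -/
def chartPoint (z : Fin (n + 1) → ℂ) (hz : z i ≠ 0) : Literature.AlgebraicGeometry.Motives.ComplexPoints (chartScheme n i) :=
  Literature.AlgebraicGeometry.Motives.AlgPoints.ofAlgHom (awayEval n z hz)

/-- The chart point with homogeneous coordinates `z` lies in `D(q)` iff `q(z) ≠ 0`. [folklore] -/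
theorem pt_chartPoint_mem_basicOpen_iff (z : Fin (n + 1) → ℂ) (hz : z i ≠ 0)
    (q : Away 𝓐 (X i)) :
    (chartPoint n z hz).pt ∈ PrimeSpectrum.basicOpen q ↔ awayEval n z hz q ≠ 0 :=
  Literature.AlgebraicGeometry.Motives.AlgPoints.pt_ofAlgHom_mem_basicOpen_iff _ q

/-- The chart point with homogeneous coordinates `z` maps to the point of `ℙⁿ_ℂ` with homogeneous
coordinates `z`: both lie in the same basic opens `D₊(g)` (`g(z) ≠ 0`), and complex points of a
`ℂ`-scheme locally of finite type are determined by their underlying point (Nullstellensatz).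
[Hartshorne II Prop. 2.5, Ex. 2.14] [folklore] -/
theorem map_chartι_chartPoint (z : Fin (n + 1) → ℂ) (hz : z i ≠ 0) :
    Literature.AlgebraicGeometry.Motives.AlgPoints.map (chartι n i) (chartPoint n z hz) =
      pointOfVec n z (Function.ne_iff.mpr ⟨i, hz⟩) := by
  refine Literature.AlgebraicGeometry.Motives.ComplexPoints.ext_of_pt_eq (Proj.ext_of_forall_mem_basicOpen_iff 𝓐 fun m hm g hg ↦ ?_)
  refine (pt_map_chartι_mem_basicOpen_iff n i _ hm hg).trans ?_
  refine ((pt_chartPoint_mem_basicOpen_iff n z hz _).trans ?_).trans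
    (pt_pointOfVec_mem_basicOpen_iff n _ _ hm hg).symm
  rw [Away.isLocalizationElem, awayEval_awayMk, pow_one, div_ne_zero_iff,
    and_iff_left (pow_ne_zero m hz)]

/-- Every complex point of the chart `Uᵢ` is a `chartPoint`, with coordinates the values of the
`xⱼ/xᵢ` (a `ℂ`-algebra map out of `ℂ[x₀,…,xₙ]_{(xᵢ)}` is determined by its values on the
generators `xⱼ/xᵢ`, `awayMk_eq_aeval_awayCoord`). [Mumford, *Red Book* I §10] [folklore] -/
theorem chartPoint_toAlgHom_awayCoord (Q : Literature.AlgebraicGeometry.Motives.ComplexPoints (chartScheme n i)) :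
    chartPoint n (fun j ↦ Literature.AlgebraicGeometry.Motives.AlgPoints.toAlgHom Q (awayCoord n i j))
      (by simp) = Q := by
  conv_rhs => rw [← Literature.AlgebraicGeometry.Motives.AlgPoints.ofAlgHom_toAlgHom Q]
  unfold chartPoint
  congr 1
  refine AlgHom.ext fun q ↦ ?_
  obtain ⟨m, g, hg, rfl⟩ := Away.mk_surjective 𝓐 (Literature.AlgebraicGeometry.Motives.ProjectiveSpace.X_mem i) q
  rw [awayEval_awayMk, algHom_awayMk_eq_eval]
  simp

/-- Every complex point of the chart `Uᵢ` has homogeneous coordinates. [Mumford, *Red Book* I §10]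
[folklore] -/
theorem chartPoint_surjective (Q : Literature.AlgebraicGeometry.Motives.ComplexPoints (chartScheme n i)) :
    ∃ (z : Fin (n + 1) → ℂ) (hz : z i ≠ 0), chartPoint n z hz = Q :=
  ⟨_, _, chartPoint_toAlgHom_awayCoord n Q⟩


/-! #### Coordinates as global sections of the chart scheme -/

/-- The coordinate `xⱼ/xᵢ` as a global section of `Uᵢ = Spec ℂ[x₀,…,xₙ]_{(xᵢ)}`. [folklore] -/
def coordSection (i j : Fin (n + 1)) : Γ((chartScheme n i).left, ⊤) :=
  (Scheme.ΓSpecIso (.of (Away 𝓐 (X i)))).inv (awayCoord n i j)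

/-- The value of the coordinate `xⱼ/xᵢ` at the point given by `e` is `e (xⱼ/xᵢ)`. [folklore] -/
theorem eval_coordSection_ofAlgHom (e : Away 𝓐 (X i) →ₐ[ℂ] ℂ) (h) (j : Fin (n + 1)) :
    (Literature.AlgebraicGeometry.Motives.AlgPoints.ofAlgHom e).eval ⊤ h (coordSection n i j) = e (awayCoord n i j) := by
  rw [Literature.AlgebraicGeometry.Motives.AlgPoints.eval_ofAlgHom_top, coordSection, Iso.inv_hom_id_apply]

/-- The value of the coordinate `xⱼ/xᵢ` at the chart point with homogeneous coordinates `z` is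
`zⱼ/zᵢ`. [folklore] -/
theorem eval_coordSection_chartPoint (z : Fin (n + 1) → ℂ) (hz : z i ≠ 0) (h) (j : Fin (n + 1)) :
    (chartPoint n z hz).eval ⊤ h (coordSection n i j) = z j / z i := by
  rw [chartPoint, eval_coordSection_ofAlgHom, awayEval_awayCoord]

variable (i)

/-- Every global regular function on the chart `Uᵢ` is a polynomial in the coordinates
`xⱼ/xᵢ` (as a function on complex points): `g/xᵢᵐ = g(x₀/xᵢ, …, xₙ/xᵢ)`. [folklore] -/
theorem exists_eval_eq_eval_coordSection (a : Γ((chartScheme n i).left, ⊤)) :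
    ∃ p : MvPolynomial (Fin (n + 1)) ℂ, ∀ (Q : Literature.AlgebraicGeometry.Motives.ComplexPoints (chartScheme n i))
      (h : Q.pt ∈ (⊤ : (chartScheme n i).left.Opens)),
      Q.eval ⊤ h a = MvPolynomial.eval (fun j ↦ Q.eval ⊤ h (coordSection n i j)) p := by
  obtain ⟨m, g, hg, hq⟩ := Away.mk_surjective 𝓐 (Literature.AlgebraicGeometry.Motives.ProjectiveSpace.X_mem i)
    ((Scheme.ΓSpecIso (.of (Away 𝓐 (X i)))).hom a)
  refine ⟨g, fun Q h ↦ ?_⟩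
  obtain ⟨e, rfl⟩ := Literature.AlgebraicGeometry.Motives.AlgPoints.ofAlgHom_surjective Q
  simp only [eval_coordSection_ofAlgHom]
  rw [Literature.AlgebraicGeometry.Motives.AlgPoints.eval_ofAlgHom_top, ← hq, algHom_awayMk_eq_eval]

/-- `z ↦` the chart point with homogeneous coordinates `z` is continuous on `{zᵢ ≠ 0}` (its
coordinates `zⱼ/zᵢ` are continuous, `AlgPoints.continuous_of_continuous_eval`).
[Serre, GAGA §2 n°5 Lemme 1] [folklore] -/
theorem continuous_chartPoint :
    Continuous fun v : {v : Fin (n + 1) → ℂ // v i ≠ 0} ↦ chartPoint n v.1 v.2 := by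
  refine Literature.AlgebraicGeometry.Motives.AlgPoints.continuous_of_continuous_eval
    (isAffineOpen_top (Spec (.of (Away 𝓐 (X i))))) (coordSection n i)
    (exists_eval_eq_eval_coordSection n i) _ (fun _ ↦ trivial) ?_
  have : (fun (v : {v : Fin (n + 1) → ℂ // v i ≠ 0}) j ↦
      (chartPoint n v.1 v.2).eval ⊤ trivial (coordSection n i j)) = fun v j ↦ v.1 j / v.1 i := by
    funext v j
    exact eval_coordSection_chartPoint n v.1 v.2 _ j
  rw [this]
  refine continuous_pi fun j ↦ ?_
  exact ((continuous_apply j).comp continuous_subtype_val).div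
    ((continuous_apply i).comp continuous_subtype_val) fun v ↦ v.2

/-- Homogeneous coordinates `(x₀/xᵢ, …, 1, …, xₙ/xᵢ)` of a complex point of the chart `Uᵢ`.
[folklore] -/
def chartCoords (Q : Literature.AlgebraicGeometry.Motives.ComplexPoints (chartScheme n i)) : Fin (n + 1) → ℂ :=
  fun j ↦ Literature.AlgebraicGeometry.Motives.AlgPoints.evalOrZero ⊤ (coordSection n i j) Q

/-- The `j`-th homogeneous coordinate of `Q` is the value of `xⱼ/xᵢ` at `Q`. [folklore] -/
theorem chartCoords_apply (Q : Literature.AlgebraicGeometry.Motives.ComplexPoints (chartScheme n i)) (j : Fin (n + 1)) :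
    chartCoords n i Q j = Literature.AlgebraicGeometry.Motives.AlgPoints.toAlgHom Q (awayCoord n i j) := by
  rw [chartCoords, Literature.AlgebraicGeometry.Motives.AlgPoints.evalOrZero_of_mem _ (Set.mem_univ _)]
  conv_lhs => rw [← Literature.AlgebraicGeometry.Motives.AlgPoints.ofAlgHom_toAlgHom Q]
  exact eval_coordSection_ofAlgHom n _ _ j

/-- The `i`-th homogeneous coordinate of a point of `Uᵢ` is normalised to `1`. [folklore] -/
@[simp]
theorem chartCoords_apply_self (Q : Literature.AlgebraicGeometry.Motives.ComplexPoints (chartScheme n i)) : chartCoords n i Q i = 1 := by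
  rw [chartCoords_apply, awayCoord_self, map_one]

/-- The homogeneous coordinates of a point of `Uᵢ` are not all zero. [folklore] -/
theorem chartCoords_ne_zero (Q : Literature.AlgebraicGeometry.Motives.ComplexPoints (chartScheme n i)) : chartCoords n i Q ≠ 0 :=
  Function.ne_iff.mpr ⟨i, by simp⟩

/-- The homogeneous coordinates are continuous on `Uᵢ(ℂ)` (regular functions are continuous for
the strong topology). [Serre, GAGA §2 n°5 Remarque] [folklore] -/
theorem continuous_chartCoords : Continuous (chartCoords n i) :=
  continuous_pi fun _ ↦ Literature.AlgebraicGeometry.Motives.AlgPoints.continuous_evalOrZero_top _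

/-- A point of `Uᵢ(ℂ)` is the chart point of its homogeneous coordinates. [folklore] -/
@[simp]
theorem chartPoint_chartCoords (Q : Literature.AlgebraicGeometry.Motives.ComplexPoints (chartScheme n i)) :
    chartPoint n (chartCoords n i Q) (by simp) = Q := by
  convert chartPoint_toAlgHom_awayCoord n Q using 2
  exact funext (chartCoords_apply n i Q)

/-- The homogeneous coordinates of the chart point of `z` are `z/zᵢ`. [folklore] -/
theorem chartCoords_chartPoint (z : Fin (n + 1) → ℂ) (hz : z i ≠ 0) :
    chartCoords n i (chartPoint n z hz) = (z i)⁻¹ • z := by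
  funext j
  rw [chartCoords, Literature.AlgebraicGeometry.Motives.AlgPoints.evalOrZero_of_mem _ (Set.mem_univ _), eval_coordSection_chartPoint,
    Pi.smul_apply, smul_eq_mul, div_eq_inv_mul]

end Charts

/-! ### `ℙⁿ(ℂ) → ℙⁿ_ℂ(ℂ)`: definition, bijectivity, homeomorphism -/

section ProjAn


/-- Rescaling the homogeneous coordinates does not change the point of `ℙⁿ_ℂ` (it lies in the same
basic opens `D₊(g)`, `g` homogeneous). [Hartshorne II Ex. 2.14] [folklore] -/
theorem pointOfVec_smul (z : Fin (n + 1) → ℂ) (hz : z ≠ 0) (a : ℂ) (ha : a • z ≠ 0) :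
    pointOfVec n (a • z) ha = pointOfVec n z hz := by
  have ha0 : a ≠ 0 := by rintro rfl; simp at ha
  refine Literature.AlgebraicGeometry.Motives.ComplexPoints.ext_of_pt_eq (Proj.ext_of_forall_mem_basicOpen_iff 𝓐 fun m hm g hg ↦ ?_)
  refine (pt_pointOfVec_mem_basicOpen_iff n _ _ hm hg).trans (Iff.trans ?_
    (pt_pointOfVec_mem_basicOpen_iff n _ _ hm hg).symm)
  rw [eval_smul_of_isHomogeneous ((mem_homogeneousSubmodule m g).mp hg) a z, mul_ne_zero_iff,
    and_iff_right (pow_ne_zero _ ha0)]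

/-- **The comparison map `ℙⁿ(ℂ) → ℙⁿ_ℂ(ℂ)`**, `[z₀ : ⋯ : zₙ] ↦` the complex point of
`Proj ℂ[x₀, …, xₙ]` with homogeneous coordinates `z` (Mathlib `Proj.fromOfGlobalSections` applied to
`F ↦ F(z)`). [Serre, GAGA §2 n°5; Hartshorne II Ex. 2.14, Thm. 7.1] [folklore] -/
def projPoint : ℙ ℂ (Fin (n + 1) → ℂ) → Literature.AlgebraicGeometry.Motives.ComplexPoints (Literature.AlgebraicGeometry.Motives.projectiveSpace n ℂ) :=
  Projectivization.lift (fun v ↦ pointOfVec n v.1 v.2) (by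
    rintro ⟨a, ha⟩ ⟨b, hb⟩ t (h : a = t • b)
    subst h
    exact pointOfVec_smul n b hb t ha)

/-- `projPoint n [v]` is the point with homogeneous coordinates `v`. [folklore] -/
@[simp]
theorem projPoint_mk (v : Fin (n + 1) → ℂ) (hv : v ≠ 0) :
    projPoint n (Projectivization.mk ℂ v hv) = pointOfVec n v hv :=
  Projectivization.lift_mk _ _ v hv

/-- On `{vᵢ ≠ 0}`, `projPoint` factors through the chart `Uᵢ(ℂ) → ℙⁿ_ℂ(ℂ)`. [folklore] -/
theorem projPoint_mk_eq_map_chartPoint {i : Fin (n + 1)} (v : Fin (n + 1) → ℂ) (hv : v i ≠ 0) :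
    projPoint n (Projectivization.mk ℂ v (Function.ne_iff.mpr ⟨i, hv⟩)) =
      Literature.AlgebraicGeometry.Motives.AlgPoints.map (chartι n i) (chartPoint n v hv) := by
  rw [projPoint_mk, map_chartι_chartPoint]

/-- `[v] ∈ φ⁻¹(D₊(g))` iff `g(v) ≠ 0`, for `g` homogeneous of positive degree. [folklore] -/
theorem pt_projPoint_mk_mem_basicOpen_iff (v : Fin (n + 1) → ℂ) (hv : v ≠ 0) {m : ℕ} (hm : 0 < m)
    {g : MvPolynomial (Fin (n + 1)) ℂ} (hg : g ∈ 𝓐 m) :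
    (projPoint n (Projectivization.mk ℂ v hv)).pt ∈ Proj.basicOpen 𝓐 g ↔
      MvPolynomial.eval v g ≠ 0 := by
  rw [projPoint_mk]
  exact pt_pointOfVec_mem_basicOpen_iff n v hv hm hg

/-- **`projPoint` is injective**: if `[v]` and `[w]` lie in the same `D₊(ℓ)` for all linear forms
`ℓ`, then the forms `wᵢ xⱼ - wⱼ xᵢ` vanish at `v`, so `v ∥ w`. [Hartshorne II Ex. 2.14]
[folklore] -/
theorem projPoint_injective : Function.Injective (projPoint n) := by
  intro p q hpq
  induction p using Projectivization.ind with | h v hv => ?_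
  induction q using Projectivization.ind with | h w hw => ?_
  have key : ∀ g ∈ 𝓐 1, (MvPolynomial.eval v g ≠ 0 ↔ MvPolynomial.eval w g ≠ 0) := fun g hg ↦ by
    rw [← pt_projPoint_mk_mem_basicOpen_iff n v hv one_pos hg,
      ← pt_projPoint_mk_mem_basicOpen_iff n w hw one_pos hg, hpq]
  obtain ⟨i, hi⟩ := Function.ne_iff.mp hv
  have hwi : w i ≠ 0 := by
    simpa using (key (X i) (Literature.AlgebraicGeometry.Motives.ProjectiveSpace.X_mem i)).mp (by simpa)
  rw [mk_eq_mk_iff']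
  refine ⟨v i / w i, funext fun j ↦ ?_⟩
  -- the linear form `wᵢ xⱼ - wⱼ xᵢ` vanishes at `w`, hence at `v`
  have hmem : w i • X j - w j • X i ∈ 𝓐 1 :=
    sub_mem (Submodule.smul_mem _ _ (Literature.AlgebraicGeometry.Motives.ProjectiveSpace.X_mem j))
      (Submodule.smul_mem _ _ (Literature.AlgebraicGeometry.Motives.ProjectiveSpace.X_mem i))
  have := (key _ hmem).not.mpr (by simp [mul_comm])
  simp only [smul_eq_C_mul, map_sub, map_mul, eval_C, eval_X, ne_eq, not_not] at this
  rw [Pi.smul_apply, smul_eq_mul]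
  field_simp
  linear_combination -this

/-- The standard opens `D₊(xᵢ)` cover `ℙⁿ`: every complex point lies in some `D₊(xᵢ)` (the
irrelevant ideal is generated by the variables, accepted `ProjectiveSpace.irrelevant_le_span`;
cf. the cover `ProjectiveSpace.chartCover`). [Hartshorne II Prop. 2.5] [folklore] -/
theorem exists_pt_mem_basicOpen_X (P : Literature.AlgebraicGeometry.Motives.ComplexPoints (Literature.AlgebraicGeometry.Motives.projectiveSpace n ℂ)) :
    ∃ i : Fin (n + 1), P.pt ∈ Proj.basicOpen 𝓐 (X i) := by
  have htop := Proj.iSup_basicOpen_eq_top 𝓐 (X : Fin (n + 1) → MvPolynomial (Fin (n + 1)) ℂ)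
    (Literature.AlgebraicGeometry.Motives.ProjectiveSpace.irrelevant_le_span n ℂ)
  have hP : P.pt ∈ (⨆ i, Proj.basicOpen 𝓐 (X i : MvPolynomial (Fin (n + 1)) ℂ)) := by
    rw [htop]; trivial
  exact Opens.mem_iSup.mp hP

/-- **`projPoint` is surjective**: a complex point of `ℙⁿ_ℂ` lies in some `D₊(xᵢ)`, lifts to the
affine chart `Uᵢ` (`AlgPoints.liftOfMemOpensRange`) and there has homogeneous coordinates
(`chartPoint_surjective`). [Hartshorne II Ex. 2.14; Mumford, *Red Book* I §10] [folklore] -/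
theorem projPoint_surjective : Function.Surjective (projPoint n) := by
  intro P
  obtain ⟨i, hi⟩ := exists_pt_mem_basicOpen_X n P
  have hi' : P.pt ∈ (chartι n i).left.opensRange := by rwa [opensRange_chartι_left]
  obtain ⟨z, hz, hQ⟩ := chartPoint_surjective n (Literature.AlgebraicGeometry.Motives.AlgPoints.liftOfMemOpensRange (chartι n i) P hi')
  refine ⟨Projectivization.mk ℂ z (Function.ne_iff.mpr ⟨i, hz⟩), ?_⟩
  rw [projPoint_mk_eq_map_chartPoint n z hz, hQ, Literature.AlgebraicGeometry.Motives.AlgPoints.map_liftOfMemOpensRange]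

/-- `projPoint` is a bijection `ℙⁿ(ℂ) ≃ ℙⁿ_ℂ(ℂ)`. [Hartshorne II Ex. 2.14] [folklore] -/
theorem projPoint_bijective : Function.Bijective (projPoint n) :=
  ⟨projPoint_injective n, projPoint_surjective n⟩

/-! #### Continuity -/

/-- `z ↦` the point with homogeneous coordinates `z` is continuous on `ℂⁿ⁺¹ ∖ {0}`: on `{zᵢ ≠ 0}`
it factors through the chart `Uᵢ(ℂ) → ℙⁿ_ℂ(ℂ)`. [Serre, GAGA §2 n°5 Lemme 1 a)] [folklore] -/
theorem continuous_pointOfVec :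
    Continuous fun v : {v : Fin (n + 1) → ℂ // v ≠ 0} ↦ pointOfVec n v.1 v.2 := by
  refine continuous_of_cover_nhds (s := fun i : Fin (n + 1) ↦ {v | v.1 i ≠ 0}) (fun v ↦ ?_)
    (fun i ↦ ?_)
  · obtain ⟨i, hi⟩ := Function.ne_iff.mp v.2
    exact ⟨i, (isOpen_ne_fun ((continuous_apply i).comp continuous_subtype_val)
      continuous_const).mem_nhds hi⟩
  · rw [continuousOn_iff_continuous_restrict]
    have : (Set.restrict {v : {v : Fin (n + 1) → ℂ // v ≠ 0} | v.1 i ≠ 0}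
        fun v ↦ pointOfVec n v.1 v.2) =
        (Literature.AlgebraicGeometry.Motives.AlgPoints.map (chartι n i)) ∘ (fun v : {w : Fin (n + 1) → ℂ // w i ≠ 0} ↦
          chartPoint n v.1 v.2) ∘ (fun v ↦ ⟨v.1.1, v.2⟩) := by
      funext v
      simp only [Function.comp_apply, Set.restrict_apply]
      exact (map_chartι_chartPoint n v.1.1 v.2).symm
    rw [this]
    have hf : Continuous fun v : {v : {v : Fin (n + 1) → ℂ // v ≠ 0} // v.1 i ≠ 0} ↦
        (⟨v.1.1, v.2⟩ : {w : Fin (n + 1) → ℂ // w i ≠ 0}) :=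
      (continuous_subtype_val.comp continuous_subtype_val).subtype_mk _
    exact (Literature.AlgebraicGeometry.Motives.AlgPoints.continuous_map (chartι n i)).comp ((continuous_chartPoint n i).comp hf)

/-- **`projPoint` is continuous** for the quotient topology on `ℙⁿ(ℂ)` and the strong topology on
`ℙⁿ_ℂ(ℂ)`. [Serre, GAGA §2 n°5 Lemme 1 a)] [folklore] -/
theorem continuous_projPoint : Continuous (projPoint n) := by
  rw [Projectivization.isQuotientMap_mk.continuous_iff]
  have : projPoint n ∘ (fun v : {v : Fin (n + 1) → ℂ // v ≠ 0} ↦ Projectivization.mk ℂ v.1 v.2) =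
      fun v ↦ pointOfVec n v.1 v.2 :=
    funext fun v ↦ projPoint_mk n v.1 v.2
  rw [this]
  exact continuous_pointOfVec n

/-! #### The inverse on a chart and openness -/

variable (i : Fin (n + 1))

/-- The point of `ℙⁿ(ℂ)` with the homogeneous coordinates of a complex point of the chart `Uᵢ`
(the inverse of `projPoint` on `D₊(xᵢ)(ℂ)`, transported to `Uᵢ(ℂ)`). [folklore] -/
def chartProj (Q : Literature.AlgebraicGeometry.Motives.ComplexPoints (chartScheme n i)) : ℙ ℂ (Fin (n + 1) → ℂ) :=
  Projectivization.mk ℂ (chartCoords n i Q) (chartCoords_ne_zero n i Q)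

/-- `chartProj` is continuous (its homogeneous coordinates are regular functions). [folklore] -/
theorem continuous_chartProj : Continuous (chartProj n i) :=
  (Projectivization.continuous_mk (𝕜 := ℂ)).comp
    ((continuous_chartCoords n i).subtype_mk (chartCoords_ne_zero n i))

/-- `projPoint ∘ chartProj` is the chart embedding `Uᵢ(ℂ) → ℙⁿ_ℂ(ℂ)`. [folklore] -/
theorem projPoint_chartProj (Q : Literature.AlgebraicGeometry.Motives.ComplexPoints (chartScheme n i)) :
    projPoint n (chartProj n i Q) = Literature.AlgebraicGeometry.Motives.AlgPoints.map (chartι n i) Q := by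
  rw [chartProj, projPoint_mk_eq_map_chartPoint n _ (by simp : chartCoords n i Q i ≠ 0),
    chartPoint_chartCoords]

/-- `chartProj` of the chart point with homogeneous coordinates `z` is `[z]`. [folklore] -/
theorem chartProj_chartPoint (z : Fin (n + 1) → ℂ) (hz : z i ≠ 0) :
    chartProj n i (chartPoint n z hz) = Projectivization.mk ℂ z (Function.ne_iff.mpr ⟨i, hz⟩) := by
  simp only [chartProj, chartCoords_chartPoint, mk_eq_mk_iff']
  exact ⟨(z i)⁻¹, rfl⟩

/-- The image of a set under `projPoint`, chart by chart: `φ(U) = ⋃ᵢ ιᵢ(chartProjᵢ⁻¹(U))`.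
[folklore] -/
theorem image_projPoint (U : Set (ℙ ℂ (Fin (n + 1) → ℂ))) :
    projPoint n '' U = ⋃ i, Literature.AlgebraicGeometry.Motives.AlgPoints.map (chartι n i) '' (chartProj n i ⁻¹' U) := by
  ext P
  simp only [Set.mem_image, Set.mem_iUnion, Set.mem_preimage]
  constructor
  · rintro ⟨p, hp, rfl⟩
    induction p using Projectivization.ind with | h v hv => ?_
    obtain ⟨i, hi⟩ := Function.ne_iff.mp hv
    refine ⟨i, chartPoint n v hi, ?_, ?_⟩
    · rwa [chartProj_chartPoint]
    · exact (projPoint_mk_eq_map_chartPoint n v hi).symm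
  · rintro ⟨i, Q, hQ, rfl⟩
    exact ⟨_, hQ, projPoint_chartProj n i Q⟩

/-- **`projPoint` is an open map**: chart by chart it is the open embedding `Uᵢ(ℂ) ↪ ℙⁿ_ℂ(ℂ)`
(`AlgPoints.isOpenEmbedding_map_holds`) precomposed with a continuous map.
[Serre, GAGA §2 n°5 Prop. 2; SGA1 XII Prop. 3.1 (xi)] [folklore] -/
theorem isOpenMap_projPoint : IsOpenMap (projPoint n) := by
  intro U hU
  rw [image_projPoint]
  exact isOpen_iUnion fun i ↦ (Literature.AlgebraicGeometry.Motives.AlgPoints.isOpenEmbedding_map_holds (chartι n i)).isOpenMap _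
    (hU.preimage (continuous_chartProj n i))

/-- **`ℙⁿ(ℂ) → ℙⁿ_ℂ(ℂ)` is a homeomorphism** onto the complex points with the strong topology
(continuous, open, bijective). [cite: SerreGAGA1956, §2 n°5 Prop. 2 and Lemme 1 a), d)] -/
theorem isHomeomorph_projPoint : IsHomeomorph (projPoint n) :=
  IsHomeomorph.mk (continuous_projPoint n) (isOpenMap_projPoint n) (projPoint_bijective n)

end ProjAn

/-! ### Holomorphy of regular functions in the standard charts -/

section ProjHol


/-- In the chart `Uᵢ`, `projPoint ∘ stdChartInv i` is the chart point with homogeneous coordinates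
`(w₁, …, 1, …, wₙ)`, mapped into `ℙⁿ`. [folklore] -/
theorem projPoint_stdChartInv (i : Fin (n + 1)) (w : Fin n → ℂ) :
    projPoint n (stdChartInv i w) =
      Literature.AlgebraicGeometry.Motives.AlgPoints.map (chartι n i) (chartPoint n (Fin.insertNth i (1 : ℂ) w) (by simp)) := by
  rw [stdChartInv, ← projPoint_mk_eq_map_chartPoint]

/-- The homogeneous coordinates of the chart point `(w₁, …, 1, …, wₙ)` are `(w₁, …, 1, …, wₙ)`.
[folklore] -/
theorem chartCoords_chartPoint_insertNth (i : Fin (n + 1)) (w : Fin n → ℂ) :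
    chartCoords n i (chartPoint n (Fin.insertNth i (1 : ℂ) w) (by simp)) = Fin.insertNth i 1 w := by
  rw [chartCoords_chartPoint, Fin.insertNth_apply_same, inv_one, one_smul]

/-- **Regular functions are holomorphic in the standard charts.** For an open `U ⊆ ℙⁿ_ℂ` and
`s ∈ Γ(ℙⁿ, U)`, the function `w ↦ s(φ[w₁ : ⋯ : 1 : ⋯ : wₙ])` is differentiable at every `w₀`
whose point lies in `U`: near `w₀` it is a quotient of polynomials in `w` with non-vanishing
denominator (`AlgPoints.exists_eval_eq_div` on the affine chart `Uᵢ`). This is Serre's Lemme 1 c)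
(regular ⇒ holomorphic). [cite: SerreGAGA1956, §2 n°5 Lemme 1 c)] -/
theorem differentiableAt_evalOrZero_projPoint_stdChartInv (U : (Literature.AlgebraicGeometry.Motives.projectiveSpace n ℂ).left.Opens)
    (s : Γ((Literature.AlgebraicGeometry.Motives.projectiveSpace n ℂ).left, U)) (i : Fin (n + 1)) (w₀ : Fin n → ℂ)
    (h₀ : (projPoint n (stdChartInv i w₀)).pt ∈ U) :
    DifferentiableAt ℂ (fun w ↦ Literature.AlgebraicGeometry.Motives.AlgPoints.evalOrZero U s (projPoint n (stdChartInv i w))) w₀ := by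
  -- transport to the affine chart `Uᵢ`
  set U' : (chartScheme n i).left.Opens := (chartι n i).left ⁻¹ᵁ U with hU'
  set s' : Γ((chartScheme n i).left, U') := (chartι n i).left.app U s with hs'
  set Qw : (Fin n → ℂ) → Literature.AlgebraicGeometry.Motives.ComplexPoints (chartScheme n i) :=
    fun w ↦ chartPoint n (Fin.insertNth i (1 : ℂ) w) (by simp) with hQw
  have hfun : (fun w ↦ Literature.AlgebraicGeometry.Motives.AlgPoints.evalOrZero U s (projPoint n (stdChartInv i w))) =
      fun w ↦ Literature.AlgebraicGeometry.Motives.AlgPoints.evalOrZero U' s' (Qw w) := by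
    funext w
    rw [projPoint_stdChartInv]
    -- naturality of the total evaluation (`AlgPoints.eval_map`; both sides are `0` off `U`)
    by_cases h : (Literature.AlgebraicGeometry.Motives.AlgPoints.map (chartι n i) (Qw w)).pt ∈ U
    · rw [Literature.AlgebraicGeometry.Motives.AlgPoints.evalOrZero_of_mem s h, Literature.AlgebraicGeometry.Motives.AlgPoints.eval_map, Literature.AlgebraicGeometry.Motives.AlgPoints.evalOrZero_of_mem]
    · rw [Literature.AlgebraicGeometry.Motives.AlgPoints.evalOrZero_of_not_mem s h, Literature.AlgebraicGeometry.Motives.AlgPoints.evalOrZero_of_not_mem]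
      exact h
  have hΦ : ∀ w, (fun j ↦ Literature.AlgebraicGeometry.Motives.AlgPoints.evalOrZero ⊤ (coordSection n i j) (Qw w)) =
      Fin.insertNth i (1 : ℂ) w :=
    fun w ↦ chartCoords_chartPoint_insertNth n i w
  have h₀' : (Qw w₀).pt ∈ U' := by
    change (Qw w₀).pt ∈ (chartι n i).left ⁻¹ᵁ U
    have : (Literature.AlgebraicGeometry.Motives.AlgPoints.map (chartι n i) (Qw w₀)).pt ∈ U := by rwa [← projPoint_stdChartInv]
    exact this
  -- local rational representation `s' = pa / pg ^ m` in the coordinates `xⱼ/xᵢ`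
  obtain ⟨pa, pg, m, hpg₀, hrep⟩ := Literature.AlgebraicGeometry.Motives.AlgPoints.exists_eval_eq_div
    (isAffineOpen_top (Spec (.of (Away 𝓐 (X i))))) (coordSection n i)
    (exists_eval_eq_eval_coordSection n i) U' s' h₀' trivial
  rw [hΦ w₀] at hpg₀
  rw [hfun]
  -- the rational function
  have hpa : DifferentiableAt ℂ (fun w : Fin n → ℂ ↦
      MvPolynomial.eval (Fin.insertNth i (1 : ℂ) w) pa) w₀ :=
    (analyticAt_eval_insertNth i pa w₀).differentiableAt
  have hpg : DifferentiableAt ℂ (fun w : Fin n → ℂ ↦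
      MvPolynomial.eval (Fin.insertNth i (1 : ℂ) w) pg ^ m) w₀ :=
    (analyticAt_eval_insertNth i pg w₀).differentiableAt.pow m
  have hrat : DifferentiableAt ℂ (fun w : Fin n → ℂ ↦
      MvPolynomial.eval (Fin.insertNth i (1 : ℂ) w) pa /
        MvPolynomial.eval (Fin.insertNth i (1 : ℂ) w) pg ^ m) w₀ := by
    simp only [div_eq_mul_inv]
    exact hpa.mul (hpg.inv (pow_ne_zero m hpg₀))
  refine hrat.congr_of_eventuallyEq ?_
  -- they agree on the open neighbourhood `{pg ≠ 0}` of `w₀`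
  have hcont : Continuous fun w : Fin n → ℂ ↦ MvPolynomial.eval (Fin.insertNth i (1 : ℂ) w) pg :=
    continuous_iff_continuousAt.mpr fun w ↦ (analyticAt_eval_insertNth i pg w).continuousAt
  have hopen : IsOpen {w : Fin n → ℂ | MvPolynomial.eval (Fin.insertNth i (1 : ℂ) w) pg ≠ 0} :=
    isOpen_ne_fun hcont continuous_const
  refine Filter.eventuallyEq_of_mem (hopen.mem_nhds hpg₀) fun w (hw : _ ≠ 0) ↦ ?_
  obtain ⟨hQ, hval⟩ := hrep (Qw w) trivial (by rwa [hΦ w])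
  rw [hΦ w] at hval
  rw [Literature.AlgebraicGeometry.Motives.AlgPoints.evalOrZero_of_mem _ hQ, hval]

/-- **Regular functions on `ℙⁿ_ℂ` pull back to holomorphic functions on `ℙⁿ(ℂ)`** (with its
standard atlas): for an open `U ⊆ ℙⁿ_ℂ` and `s ∈ Γ(ℙⁿ, U)`, `p ↦ s(φ p)` is holomorphic on
`φ⁻¹(U(ℂ))`. [cite: SerreGAGA1956, §2 n°5 Lemme 1 c) and Prop. 2] -/
theorem mdifferentiableOn_evalOrZero_projPoint (U : (Literature.AlgebraicGeometry.Motives.projectiveSpace n ℂ).left.Opens)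
    (s : Γ((Literature.AlgebraicGeometry.Motives.projectiveSpace n ℂ).left, U)) :
    MDifferentiableOn 𝓘(ℂ, Fin n → ℂ) 𝓘(ℂ, ℂ) (fun p ↦ Literature.AlgebraicGeometry.Motives.AlgPoints.evalOrZero U s (projPoint n p))
      (projPoint n ⁻¹' {P | P.pt ∈ U}) := by
  intro p hp
  refine (Projectivization.mdifferentiableAt_of_differentiableAt_stdChartInv ?_
    fun i hi ↦ ?_).mdifferentiableWithinAt
  · exact ContinuousAt.comp (f := projPoint n) (g := Literature.AlgebraicGeometry.Motives.AlgPoints.evalOrZero U s)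
      ((Literature.AlgebraicGeometry.Motives.AlgPoints.continuousOn_evalOrZero U s).continuousAt
        ((Literature.AlgebraicGeometry.Motives.AlgPoints.isOpen_setOf_pt_mem U).mem_nhds hp))
      (continuous_projPoint n).continuousAt
  · have hp' : stdChartInv i (stdChartFun i p) = p := stdChartInv_stdChartFun i hi
    refine differentiableAt_evalOrZero_projPoint_stdChartInv n U s i (stdChartFun i p) ?_
    rw [hp']
    exact hp

/-- **Compatibility with homogeneous coordinates**: `φ⁻¹(D₊(F)(ℂ))` is the complement of the
projective zero locus of `F`, for `F` homogeneous. [Hartshorne II §2; Serre, GAGA §2 n°5]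
[folklore] -/
theorem preimage_projPoint_setOf_pt_mem_basicOpen (F : MvPolynomial (Fin (n + 1)) ℂ) (m : ℕ)
    (hF : F.IsHomogeneous m) :
    projPoint n ⁻¹' {P | P.pt ∈ Proj.basicOpen 𝓐 F} = (projZeroLocus {F})ᶜ := by
  ext p
  induction p using Projectivization.ind with | h v hv => ?_
  simp only [Set.mem_preimage, Set.mem_setOf_eq, Set.mem_compl_iff]
  by_cases hF0 : F = 0
  · subst hF0
    have h1 : Projectivization.mk ℂ v hv ∈
        projZeroLocus ({0} : Set (MvPolynomial (Fin (n + 1)) ℂ)) := by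
      simp [projZeroLocus]
    have h2 : (projPoint n (Projectivization.mk ℂ v hv)).pt ∉
        Proj.basicOpen 𝓐 (0 : MvPolynomial _ ℂ) := by
      rw [Proj.basicOpen_zero]; exact id
    simp only [h1, h2, not_true_eq_false]
  have hS : ∀ G ∈ ({F} : Set (MvPolynomial (Fin (n + 1)) ℂ)), G.IsHomogeneous G.totalDegree := by
    rintro G rfl; rwa [hF.totalDegree hF0]
  rw [mem_projZeroLocus_mk_iff hS]
  simp only [Set.mem_singleton_iff, forall_eq]
  rcases Nat.eq_zero_or_pos m with rfl | hm
  · -- `F = C c` is a nonzero constant: both sides hold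
    obtain ⟨c, rfl⟩ : ∃ c, F = C c := ⟨_, (totalDegree_eq_zero_iff_eq_C).mp (hF.totalDegree hF0)⟩
    have hc : c ≠ 0 := by rintro rfl; simp at hF0
    have hunit : IsUnit (C c : MvPolynomial (Fin (n + 1)) ℂ) := (Ne.isUnit hc).map C
    simp only [eval_C, hc, not_false_eq_true, iff_true]
    exact (Proj.mem_basicOpen 𝓐 (C c) _).mpr fun h ↦
      (projPoint n (Projectivization.mk ℂ v hv)).pt.isPrime.ne_top
        (Ideal.eq_top_of_isUnit_mem _ h hunit)
  · exact pt_projPoint_mk_mem_basicOpen_iff n v hv hm ((mem_homogeneousSubmodule m F).mpr hF)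

/-- **`ℙⁿ(ℂ)` with its standard atlas is the analytification of `ℙⁿ_ℂ`** via `projPoint`.
[cite: SerreGAGA1956, §2 n°5 Prop. 2 (applied to the algebraic charts `D₊(xᵢ) ≅ 𝔸ⁿ`)] -/
theorem isAnalytification_projPoint :
    IsAnalytification (Fin n → ℂ) (Literature.AlgebraicGeometry.Motives.projectiveSpace n ℂ) n (projPoint n) where
  isHomeomorph := isHomeomorph_projPoint n
  finrank_eq := Module.finrank_fin_fun ℂ
  mdifferentiableOn_evalOrZero U s := mdifferentiableOn_evalOrZero_projPoint n U s

end ProjHol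

end Proj

/-- **Discharge of `Literature.NumberTheory.Transcendental.exists_isAnalytification_proj`**: `ℙⁿ(ℂ)` (Mathlib's projectivization
`ℙ ℂ ℂⁿ⁺¹` with the quotient topology and the standard atlas of
`Literature.NumberTheory.Transcendental.ProjectiveSpace`) is the analytification of the `ℂ`-scheme
`ℙⁿ_ℂ = Proj ℂ[x₀, …, xₙ]` (`Literature.projectiveSpace n ℂ`): the map `Literature.projPoint n`,
`[z₀ : ⋯ : zₙ] ↦` the complex point with homogeneous coordinates `z`, is a homeomorphism onto
`ℙⁿ_ℂ(ℂ)` with the strong topology, regular functions pull back to holomorphic functions, and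
`φ⁻¹(D₊(F)(ℂ)) = ℙⁿ(ℂ) ∖ V(F)` for `F` homogeneous. In the printed source this is §2 n°5,
Prop. 2 (existence and uniqueness of the analytic structure `X^h` for which every algebraic chart
is an analytic chart) applied to the algebraic charts `D₊(xᵢ) ≅ 𝔸ⁿ` of `ℙⁿ`, together with
Lemme 1 (a: the usual topology is finer than the Zariski topology; c: regular functions are
holomorphic); the fact's docstring locator "§2 Exemple 2" does not exist in the paper.
[cite: SerreGAGA1956, §2 n°5 Prop. 2 and Lemme 1] -/
theorem exists_isAnalytification_proj_holds : exists_isAnalytification_proj := fun n ↦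
  ⟨projPoint n, isAnalytification_projPoint n, fun F m hF ↦
    preimage_projPoint_setOf_pt_mem_basicOpen n F m hF⟩

end Literature.NumberTheory.Transcendental
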